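import Literature.MathematicalPhysics.QuantumFieldTheory.Balaban1983to89.B6Eq238MultiLevelTorusL0
import Literature.MathematicalPhysics.QuantumFieldTheory.Balaban1983to89.B6Geom246MultiLevelTorusL0
import Literature.MathematicalPhysics.QuantumFieldTheory.Balaban1983to89.B6Prop22MultiLevelBoxL0
import Literature.MathematicalPhysics.QuantumFieldTheory.Balaban1983to89.B6Prop22MultiLevelTorus
/-!
# `Balaban1983to89.B6Prop22MultiLevelTorusL0` — LEVEL-0 TWIN (programme G-F3′-L0, director-ym LINE №27 / UV3-NODE §24.5; plan `lit-balaban-r03/G-F3L0-PLAN.md`) of `B6Prop22MultiLevelTorus`: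
the same declarations, SAME NAMES AND STATEMENTS, for nested families WITH print's region `Λ₀ = T ∖ Ω₁` ADMITTED (structures
`B6MultiLevelBoxOperatorL0.Domains` / `B6MultiLevelTorusOperatorL0.TDomains`: levels `0, …, k`, the level-`0` block a single site, `Q′₀ = id`,
finite weight `a₀` — print p.225 (2.14) «Σ_{j=0}^k … (Q′₀λ)(x) = λ(x), x ∈ Λ₀», p.229 «taking a sequence (2.1) … smallest possible domains B^j(Λ_j),
and considering the operator Δ_a defined by (2.19), (2.20) for this sequence»).  Every `D`-free object is the lineage's, consumed BY NAME; no existing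
module is touched; no fact is minted.  Unit `lit-balaban-p33` (S-B hands, p33 gen 87; packet S-B owner p21 gen 26; port tooling by r03 gen 36); B6 fold owner r03; referee ref-4.  THE TWIN'S DOCUMENTATION FOLLOWS
VERBATIM (its «levels 1 … k» / «Ω₁ = X» sentences describe the twin; here `j` runs from `0` and `Ω₁` may be a proper subset).

# `Balaban1983to89.B6Prop22MultiLevelTorus` — [B6] PROPOSITION 2.2, FIRST ENTRY OF (2.67), FOR THE GENUINE `k`-LEVEL
OPERATOR `G′ = Δ′_a^{−1}` ON THE TORUS `T_η` (print's carrier, `Ω₁ = T_η`): `|(G′λ)(x)| ≤ O(1)(L^jη)²e^{−½δ₀d(y,y′)}|λ|`,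
`x ∈ B^j(y)`, `supp λ ⊂ B^{j′}(y′)` — by the printed route (2.64)–(2.66) read THROUGH THE TRANSLATION CHARTS of files
T1–T3: every row of a torus cube term IS a row of the corresponding box cube term of the translated family, so the
box lineage's per-cube bounds (2.43)/(2.44) give the majorants of `R` and `G′₀` on the torus blocks `𝔅`; then the fixed
point `G′ = G′₀ + G′R` of (2.38)^T and the chain of Lemma 2.1 on the torus (file T4 of the torus carrier of the multi-level
parametrix; no existing module is touched; no fact is minted)

FRAMING (verbatim cell line):
statement-level skeleton of published theorems with citation tags; proofs where landed; nothing here is a claim about the Yang–Mills mass gap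

Source under audit (cell pub-balaban / lit-balaban): T. Bałaban, *Propagators and renormalization transformations for
lattice gauge theories. II*, Commun. Math. Phys. **96** (1984) 223–250 [`Balaban1984PropagatorsII`, "B6"], p. 224 [PDF 2]
(«we admit the case when some domains Ω_j are equal to T_η»), p. 229–230 [PDF 7–8] (2.36)–(2.44), p. 232 [PDF 10]
(2.51)–(2.55), p. 234 [PDF 12] (2.64)–(2.67), Proposition 2.2 (held text `paper:balaban1984-cmp96-propagators-rt-ii`,
p0002/p0007/p0008/p0010/p0012).  Unit `lit-balaban-p21` (Phase-2 proof seat p21 gen 15), HOME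
`run/shared/lean/pub/lit-balaban/`, B6 fold owner r03, referee ref-4.  Box sibling (consumed BY NAME, untouched):
`B6Prop22MultiLevelBox` (p21 gen 10: `rML_majorant`, `gZeroML_majorant`, `prop22_first_multiLevelBox` and the per-cube
row lemmas `bX_row_img`/`bX_row_off`/`gX_row_img`/`gX_row_off`/`Dd_le_supNorm`/`mem_keySet_of_aX_ne_zero`).

## WHAT IS PRINTED (p. 234, verbatim up to notation)

«From the lemma and (2.55) we get |(Rλ)(x)| ≤ O(1)ⁿc₁ⁿe^{−½δ₀d(y,y′)}|λ|, x ∈ B^j(y), supp λ ⊂ B^{j′}(y′). (2.64)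
Applying this inequality to the n^{th} power of the operator R in (2.38) we have |(Rⁿλ)(x)| ≤ (O(M^{−1})c₁)ⁿ
e^{−½δ₀d(y,y′)}|λ|, (2.65) and this implies finally for x ∈ B^j(y), supp λ ⊂ B^{j′}(y′),
|(G′λ)(x)| ≤ Σ_{n=0}^∞ |(G′₀Rⁿλ)(x)| ≤ … ≤ O(1)(L^jη)²e^{−½δ₀d(y,y′)}|λ|. (2.66) …
**Proposition 2.2.** If we have (2.1), (2.2) and M is sufficiently large, then the operator G′ = Δ′_a^{−1} (a = 1)
satisfies the inequalities |(G′λ)(x)|, … ≤ O(1)[(L^jη)², …]·e^{−½δ₀d(y,y′)}|λ|, x ∈ B^j(y) …, y ∈ Λ_j,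
supp λ ⊂ B^{j′}(y′), y′ ∈ Λ_{j′}. (2.67)»  (p. 224: the domains are «T_η ⊃ Ω₁ ⊃ Ω₂ ⊃ … ⊃ Ω_k (we admit the case when
some domains Ω_j are equal to T_η)» — the carrier is the torus.)

## WHAT THIS FILE CERTIFIES (kernel-checked; setting of files T1–T3)

For the genuine `k`-level operator `Δ′_a = mlOpT` of a nested family `D : TDomains d ℓ M_h k P R` of domains of the
TORUS (file T1), its cover `𝒟`, `G′₀ = gZeroT`, `R = rT` (file T2), the torus blocks `𝔅`, `y(x) = blkOf x` and the
torus distance `d_T` of `geomT D` (file T3), in the majorant language of `B6RandomWalk`: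
* §1 tools and **THE CHART TRANSFER**: a block-supported `λ` on the torus, read in the chart `σ_s` (`λ ∘ σ_s`), is
  block-supported in the chart family with the same bound (`blockSupp_chart`: the block map `blkMap` of file T3 is a
  bijection commuting with `blkOf`); the torus distance from the block of `x` is at most the chart distance from the
  block of `σ_s⁻¹x` (`distT_blkOf_le_chart`); the periodic relabelling `Qmap` of file T2 sends the central label of a
  torus cube meeting the row of `x` (in the chart) to a candidate centre AT `x` (`qmap_mem_near`), so the torus cubes whose
  term meets the row of `x` are keyed injectively (`keyT_injective`) into the box lineage's `keySet` at `x`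
  (`mem_keySet_of_bT_ne_zero`, `mem_keySet_of_aT_ne_zero`): at most `3·2^{d+1}` terms per row, on the torus too;
* §2 **(2.64) FOR THE GENUINE OPERATOR ON THE TORUS** `rT_majorant`: `R` has the majorant `(K/M)·e^{−δ₁d_T(y,y′)/(d+1)}`
  for all `k`, `M_h ≥ 3`, `R ≥ 2L`, torus sizes `P` (`P_μ ≥ 4`), families `D` and weights in the windows, with THE SAME
  `(δ₁, K)` AS THE BOX LINEAGE (functions of `d`, `ℓ`, windows only — uniform in the torus) — each transported term
  `σ(K(h_□)G′(□)v_□)σ⁻¹` is bounded by the box lineage's decaying (2.44) (`local_comm_bound`) of the central cube of its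
  chart, the support distance read from `d_{chart} ≥ d_T`;
* §3 **THE MAJORANT OF `G′₀` ON THE TORUS** `gZeroT_majorant`: `A·L^{2j}·e^{−δ₂d_T(y,y′)/(d+1)}` — from (2.43) per cube in
  the chart (`ineq243_twoLevel_roww`, `mulVec_le_of_roww`), the factor `L^{2i_□} ≤ L^{2j}`, and the finite overlap;
* §4 **PROPOSITION 2.2, FIRST ENTRY, ON THE TORUS** `prop22_first_multiLevelTorus`: there are `δ₀, C, M₀ > 0` and `N₀`
  (functions of `d`, `ℓ` and the windows — NOT of the torus) such that for every `k`, `M_h ≥ 3` with `L·M_h ≥ M₀` («M is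
  sufficiently large»), `R ≥ 2L` with `R·M ≥ N₀ + 1` ((2.59)), every torus size `P` with `P_μ ≥ 4`, nested family `D` of
  domains of the torus ((2.1)–(2.2) with the torus distance) and weights in the windows with `a_{i+1} = aNext ℓ a_i c_i`:
  `|(G′λ)(x)| ≤ C·L^{2j}·e^{−½δ₀d_T(y,y′)}|λ|` for `x ∈ B^j(y)`, `supp λ ⊂ B^{j′}(y′)` — the fixed point `G′ = G′₀ + G′R`
  (`fixedPoint_gmlT`, from (2.38)^T `eq238_multiLevelTorus` and `G′Δ′_a = 1` with positivity of the weights needed at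
  levels `≥ 1` only: `mlOpT_congr_weights`, `gmlT_mul_mlOpT_pos`) fed, with §2–§3 and Lemma 2.1 on the torus
  (`B6Geom246MultiLevelTorusL0.lemma21_torus`, `α = ½`), to the chain `B6Prop23Chain.majorant_of_fixedPoint_266W`.

## HONEST SCOPE

As files T1–T3: levels `1 … k` with `Ω₁ = T_η` (print: `j = 0 … k` with `Λ₀`, `a₀ = +∞` — not modelled), `m² = 0`, the
asymmetric partition of the lineage, `M_h ≥ 3`, torus side `(M·L^k)·P_μ` with `P_μ ≥ 4` (what the charts need; print's
torus is astronomically larger than a cube); lattice units (`G′` here is `η^{−2}·G′` of print, whence `L^{2j}` for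
«(L^jη)²»); the (2.61)-constant is the `L`-dependent series constant of `B6Ineq261LevelGap` (print's `c₁(α)` is refuted
as typed); all constants existential (functions of `d`, `ℓ`, windows).  Only the FIRST entry of (2.67) is certified here
(the derivative/Hölder/Laplacian entries of the box lineage's files 6–13 are not transported in this file).  Nothing is
inferred from the manuscript: every step is kernel-checked.
-/

namespace Literature.MathematicalPhysics.QuantumFieldTheory.Balaban1983to89.B6Prop22MultiLevelTorusL0

open Finset Matrix
open Literature.MathematicalPhysics.QuantumFieldTheory.Balaban1983to89.B4ContourShift (supNorm abs_le_supNorm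
  supNorm_nonneg)
open Literature.MathematicalPhysics.QuantumFieldTheory.Balaban1983to89.B4Reflection242 (boxDom mem_boxDom blk)
open Literature.MathematicalPhysics.QuantumFieldTheory.Balaban1983to89.B4Lemma22ReduceZero (Box)
open Literature.MathematicalPhysics.QuantumFieldTheory.Balaban1983to89.B4PartitionUnity22 (hprof D1 D2 D1_nonneg D2_nonneg
  contDiff_hprof hasCompactSupport_hprof)
open Literature.MathematicalPhysics.QuantumFieldTheory.Balaban1983to89.B4Thm110ZeroBox (boxCast boxCast_apply_val
  boxCast_symm_apply_val mem_boxDom_of_eq roww mulVec_le_of_roww)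
open Literature.MathematicalPhysics.QuantumFieldTheory.Balaban1983to89.B6Ineq243TwoLevelBox hiding ineq243_twoLevel_deriv_value ineq243_twoLevel_deriv_wsum ineq243_twoLevel_dist ineq243_twoLevel_rowSum_colSum ineq243_twoLevel_roww ineq243_twoLevel_value ineq244_twoLevel
open Literature.MathematicalPhysics.QuantumFieldTheory.Balaban1983to89.B6Ineq243TwoLevelBoxL0
open Literature.MathematicalPhysics.QuantumFieldTheory.Balaban1983to89.B6Partition236TwoLevelBox
open Literature.MathematicalPhysics.QuantumFieldTheory.Balaban1983to89.B6Eq238TwoLevelBox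
open Literature.MathematicalPhysics.QuantumFieldTheory.Balaban1983to89.B6Ineq249TwoLevelBox (near card_near_le
  mem_near_of_abs_lt emb_sub_emb)
open Literature.MathematicalPhysics.QuantumFieldTheory.Balaban1983to89.B6MultiLevelBoxOperator hiding Domains mlOp_apply
open Literature.MathematicalPhysics.QuantumFieldTheory.Balaban1983to89.B6MultiLevelBoxOperatorL0
open Literature.MathematicalPhysics.QuantumFieldTheory.Balaban1983to89.B6Eq238MultiLevelBox hiding Active CubeData Down Ep LamG aX bX cG cOp cOp_mul_cG ctrs_Pj_subset cubeData_of_mem cubeSet diagonal_mul_eq_pad eq238_multiLevelBox fin fin_data fin_spec gX gZeroML isBlockUnion_LamG lev_corner_ublk mem_LamG mem_cubeSet mlOp_emb_emb mlOp_emb_off mlOp_mul_aX mlOp_mul_term rML row_eq_pad_row sum_uv_eq_one vFun vX window_of_active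
open Literature.MathematicalPhysics.QuantumFieldTheory.Balaban1983to89.B6Eq238MultiLevelBoxL0
open Literature.MathematicalPhysics.QuantumFieldTheory.Balaban1983to89.B6Ineq249MultiLevelBox hiding abs_vFun_le_one bX_eq bX_mulVec_apply embC eq250_multiLevelBox innerB local_comm_bound mem_keySet_of_bX_ne_zero norm_rML_le
open Literature.MathematicalPhysics.QuantumFieldTheory.Balaban1983to89.B6Ineq249MultiLevelBoxL0
open Literature.MathematicalPhysics.QuantumFieldTheory.Balaban1983to89.B6Geom246MultiLevelBox hiding Touch blkOf blkOf_corner blkOf_eq_iff_blk blkOf_eq_of_blk_i_eq blkOf_val bond bond_adj bset cen connected coord_bounds corner corner_mem csys dist_blkOf_le_box dist_blkOf_le_coord dist_blkOf_le_line dist_cen_le_of_adj dist_cen_le_of_touch dist_le_one_of_near dist_toR_cen_le exists_blkOf_eq geom lemma21_box lev_corner lev_eq_of_blkOf_eq levelGap pack reachable_blkOf reachable_of_near realizes scale_bounds touch_symm triangle_refl_nonneg walk_disp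
open Literature.MathematicalPhysics.QuantumFieldTheory.Balaban1983to89.B6Geom246MultiLevelBoxL0
open Literature.MathematicalPhysics.QuantumFieldTheory.Balaban1983to89.B6Prop22MultiLevelBox hiding Dd_le_supNorm aX_mulVec_apply bX_row_img bX_row_off dist_blkOf_le_in_cube fixedPoint_gml gX_row_img gX_row_off gZeroML_majorant lev_window_of_inCube mem_keySet_of_aX_ne_zero prop22_first_multiLevelBox rML_majorant
open Literature.MathematicalPhysics.QuantumFieldTheory.Balaban1983to89.B6Prop22MultiLevelBoxL0
open Literature.MathematicalPhysics.QuantumFieldTheory.Balaban1983to89.B6RandomWalk (HasMajorant BlockSupp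
  hasMajorant_mono)
open Literature.MathematicalPhysics.QuantumFieldTheory.Balaban1983to89.B6Ineq261LevelGap (K261 K261_nonneg
  theta_lt_one_of_log)
open Literature.MathematicalPhysics.QuantumFieldTheory.Balaban1983to89.B6Prop23Chain (majorant_of_fixedPoint_266W)
open Literature.MathematicalPhysics.QuantumFieldTheory.Balaban1983to89.B6MultiLevelTorusOperator hiding TDomains mlOpT_apply mlOpT_eq_reindex_chart mlOpT_mul_reindex mlOpT_tshift
open Literature.MathematicalPhysics.QuantumFieldTheory.Balaban1983to89.B6MultiLevelTorusOperatorL0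
open Literature.MathematicalPhysics.QuantumFieldTheory.Balaban1983to89.B6Eq238MultiLevelTorus hiding CubeDataT Dc Dc_lev_symm aT aX_wall_row active_of_uT_ne_zero bT cubeDataT_of_mem cubeData_chart cubeSetT eq238_multiLevelTorus gZeroT mem_cubeSetT mlOpT_mul_aT rT sum_uv_eq_one_T vT vT_eq
open Literature.MathematicalPhysics.QuantumFieldTheory.Balaban1983to89.B6Eq238MultiLevelTorusL0
open Literature.MathematicalPhysics.QuantumFieldTheory.Balaban1983to89.B6Geom246MultiLevelTorus hiding TouchT blkHom blkMap blkMap_blkOf blkMap_injective blkMap_surjective blkOf_tshift_eq bondT bondT_adj bond_le_bondT connectedT csysT distT_le_dist_box distT_le_dist_chart dist_posT_le_of_adj dist_posT_le_of_touchT dist_site_posT_le geomT label_bounds lemma21_torus levelGapT packT posT realizesT touchT_symm triangle_refl_nonneg_T walk_dispT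
open Literature.MathematicalPhysics.QuantumFieldTheory.Balaban1983to89.B6Geom246MultiLevelTorusL0
open Literature.MathematicalPhysics.QuantumFieldTheory.Balaban1983to89.B6Prop22MultiLevelTorus (mlOpT_congr_weights
  gmlT_mul_mlOpT_pos qmap_mem_near mem_keySet_chart)

noncomputable section

variable {d : ℕ}

/-! ## §1 Tools and the chart transfer -/

section Tools

/-- a sum of terms `≤ B` (`B ≥ 0`), with at most the terms keyed (injectively) into `T` non-zero, is `≤ |T|·B`. [folklore] -/
private theorem sum_le_card_mul {ι σ : Type*} [Fintype ι] [DecidableEq σ] (f : ι → ℝ) (key : ι → σ)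
    (hkey : Function.Injective key) (T : Finset σ) (hT : ∀ i, f i ≠ 0 → key i ∈ T) {B : ℝ} (hB : 0 ≤ B)
    (hf : ∀ i, f i ≤ B) : ∑ i, f i ≤ T.card * B := by
  classical
  rw [← Finset.sum_filter_ne_zero]
  have hcard : (Finset.univ.filter fun i => f i ≠ 0).card ≤ T.card :=
    Finset.card_le_card_of_injOn key (fun i hi => by
      rw [Finset.coe_filter] at hi; exact hT i hi.2) (fun i _ j _ h => hkey h)
  calc ∑ i ∈ Finset.univ.filter (fun i => f i ≠ 0), f i
      ≤ (Finset.univ.filter fun i => f i ≠ 0).card • B := Finset.sum_le_card_nsmul _ _ _ fun i _ => hf i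
    _ = ((Finset.univ.filter fun i => f i ≠ 0).card : ℝ) * B := by rw [nsmul_eq_mul]
    _ ≤ T.card * B := by gcongr

/-- `(reindex e e A)·v` at `z` is `A·(v ∘ e)` at `e⁻¹z`. [folklore] -/
private theorem reindex_mulVec_apply {X Y : Type*} [Fintype X] [Fintype Y] (e : X ≃ Y) (A : Matrix X X ℝ) (v : Y → ℝ)
    (z : Y) : (Matrix.reindex e e A *ᵥ v) z = (A *ᵥ (v ∘ e)) (e.symm z) := by
  rw [Matrix.reindex_apply, Matrix.submatrix_mulVec_equiv, Equiv.symm_symm, Function.comp_apply]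

/-- the exponent bookkeeping: `e^{−δD/L^i} = e^{δ}·e^{−(δ/(d+1))·dist}` for `D = L^i(dist/(d+1) − 1)`. [folklore] -/
private theorem exp_Dd_eq {δ n dist : ℝ} (hn : 0 < n) (d : ℕ) :
    Real.exp (-(δ * (n * (dist / (d + 1) - 1)) / n)) = Real.exp δ * Real.exp (-(δ / (d + 1) * dist)) := by
  rw [← Real.exp_add]
  congr 1
  field_simp
  ring

end Tools

section Chart

variable {ℓ Mh k R : ℕ} {P : Fin (d + 1) → ℕ} {D : TDomains d ℓ Mh k P R}

/-- **A BLOCK-SUPPORTED VECTOR READ IN A CHART IS BLOCK-SUPPORTED IN THE CHART FAMILY** (same bound, the block pulled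
back along the block bijection `blkMap` of file T3). [cite: Balaban1984PropagatorsII, (2.51) p.232, dictionary] -/
theorem blockSupp_chart (hMh : 1 ≤ Mh) (hP : ∀ μ, 1 ≤ P μ) (s : Fin (d + 1) → ℤ)
    {μ : ↥(boxDom (N0 ℓ Mh k P)) → ℝ} {y' : ↥(B6Geom246MultiLevelBoxL0.bset D.toDomains)} {B : ℝ}
    (hμ : BlockSupp (g := geomT D) (blkOf D.toDomains) μ y' B) {b : ↥(bset (D.chart s).toDomains)}
    (hb : blkMap D s b = y') :
    BlockSupp (g := geom (D.chart s).toDomains) (blkOf (D.chart s).toDomains)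
      (μ ∘ tshift (N0 ℓ Mh k P) (B6MultiLevelTorusOperator.TDomains.tvec ℓ Mh k s)) b B := by
  refine ⟨hμ.nonneg, fun w hw => hμ.bound _ ?_, fun w hw => hμ.off _ fun h => hw ?_⟩
  · rw [← hb, ← hw, blkMap_blkOf hMh hP]
  · exact blkMap_injective hMh hP s (by rw [blkMap_blkOf hMh hP, h, hb])

/-- **THE TORUS DISTANCE FROM THE BLOCK OF `x` IS AT MOST THE CHART DISTANCE FROM THE BLOCK OF `σ_s⁻¹x`**.
[cite: Balaban1984PropagatorsII, (2.46) p.231, dictionary] -/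
theorem distT_blkOf_le_chart (hMh : 1 ≤ Mh) (hP : ∀ μ, 1 ≤ P μ) (s : Fin (d + 1) → ℤ)
    (x : ↥(boxDom (N0 ℓ Mh k P))) (b : ↥(bset (D.chart s).toDomains)) :
    (bondT D).dist (blkOf D.toDomains x) (blkMap D s b)
      ≤ (bond (D.chart s).toDomains).dist
          (blkOf (D.chart s).toDomains ((tshift (N0 ℓ Mh k P) (B6MultiLevelTorusOperator.TDomains.tvec ℓ Mh k s)).symm x)) b := by
  have h := distT_le_dist_chart (D := D) hMh hP s
    (blkOf (D.chart s).toDomains ((tshift (N0 ℓ Mh k P) (B6MultiLevelTorusOperator.TDomains.tvec ℓ Mh k s)).symm x)) b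
  rwa [blkMap_blkOf hMh hP, Equiv.apply_symm_apply] at h

/-- **THE ROW SUPPORT OF A TERM OF `R` ON THE TORUS**: if `(σ(K(h_□)G′(□)v_□)σ⁻¹·v)(z) ≠ 0` for the torus cube
`□ = (j, q)`, then `(j, Qmap_z(q))` is one of the `≤ 3·2^{d+1}` keys at `z` (the box lineage's row-support lemma in the
chart). [cite: Balaban1984PropagatorsII, p.229 (cover of finite overlap), (2.44) p.230] -/
theorem mem_keySet_of_bT_ne_zero {a c : ℕ → ℝ} (hℓ : 1 ≤ ℓ) (hR : 2 * (ℓ + 1) ≤ R) (hP : ∀ μ, 1 ≤ P μ)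
    (hP4 : ∀ μ, 4 ≤ P μ) (hMh : 3 ≤ Mh) (cq : ℕ × (Fin (d + 1) → ℤ)) (hc : B6Eq238MultiLevelTorusL0.CubeDataT D cq)
    (v : ↥(boxDom (N0 ℓ Mh k P)) → ℝ) {z : ↥(boxDom (N0 ℓ Mh k P))} (hz : (bT D a c hP hP4 cq hc *ᵥ v) z ≠ 0) :
    (cq.1, Qmap ℓ Mh k P cq.1 z.1 cq.2) ∈ keySet ℓ Mh (D.lev z.1) z.1 := by
  have hMh1 : 1 ≤ Mh := le_trans (by norm_num) hMh
  unfold bT at hz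
  rw [reindex_mulVec_apply] at hz
  have h := mem_keySet_of_bX_ne_zero hℓ hR hP hMh _ (cubeData_chart hP4 hc) _ hz
  rw [Dc_lev_symm] at h
  exact mem_keySet_chart hMh1 hc.hj.2 h

/-- **THE ROW SUPPORT OF A TERM OF `G′₀` ON THE TORUS**. [cite: Balaban1984PropagatorsII, p.229 (cover of finite overlap), (2.36)–(2.37) p.229] -/
theorem mem_keySet_of_aT_ne_zero {a c : ℕ → ℝ} (hℓ : 1 ≤ ℓ) (hR : 2 * (ℓ + 1) ≤ R) (hP : ∀ μ, 1 ≤ P μ)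
    (hP4 : ∀ μ, 4 ≤ P μ) (hMh : 2 ≤ Mh) (cq : ℕ × (Fin (d + 1) → ℤ)) (hc : CubeDataT D cq)
    (v : ↥(boxDom (N0 ℓ Mh k P)) → ℝ) {z : ↥(boxDom (N0 ℓ Mh k P))} (hz : (aT D a c hP hP4 cq hc *ᵥ v) z ≠ 0) :
    (cq.1, Qmap ℓ Mh k P cq.1 z.1 cq.2) ∈ keySet ℓ Mh (D.lev z.1) z.1 := by
  unfold aT at hz
  rw [reindex_mulVec_apply] at hz
  have h := mem_keySet_of_aX_ne_zero hℓ hR hP hMh _ (cubeData_chart hP4 hc) _ hz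
  rw [Dc_lev_symm] at h
  exact mem_keySet_chart (le_trans (by norm_num) hMh) hc.hj.2 h

variable (D) in
/-- the keys of the members of the torus cover at a site are distinct (a periodic label is recovered modulo `P_j`).
[cite: Balaban1984PropagatorsII, p.229 (cover of finite overlap), dictionary] -/
theorem keyT_injective (z : Fin (d + 1) → ℤ) :
    Function.Injective (fun cq : {cq // cq ∈ B6Eq238MultiLevelTorusL0.cubeSetT D} => (cq.1.1, Qmap ℓ Mh k P cq.1.1 z cq.1.2)) := by
  intro u w h
  simp only [Prod.mk.injEq] at h
  obtain ⟨h1, h2⟩ := h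
  have hu := (mem_cubeSetT.1 u.2).2.1
  have hw := (mem_cubeSetT.1 w.2).2.1
  rw [h1] at h2 hu
  exact Subtype.ext (Prod.ext h1 (Qmap_injOn w.1.1 z hu hw h2))

end Chart

/-! ## §2 (2.64) on the torus: the majorant of `R` on `𝔅` -/

section RMajorant

/-- **[B6] (2.64) FOR THE GENUINE `k`-LEVEL OPERATOR ON THE TORUS `T_η` — THE MAJORANT OF `R` ON `𝔅`**: there are
`δ₁, K > 0` (functions of `d`, `ℓ`, windows — the SAME as the box lineage's, uniform in the torus) such that for every
`k`, `M_h ≥ 3`, `R ≥ 2L`, torus size `P` (`P_μ ≥ 4`), nested family `D` of domains of the torus and weights in the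
windows, `|(Rλ)(x)| ≤ (K/M)·e^{−(δ₁/(d+1))·d_T(y,y′)}|λ|` for `x ∈ B^j(y)`, `supp λ ⊂ B^{j′}(y′)` (`M = L·M_h`) — each
transported term `σ(K(h_□)G′(□)v_□)σ⁻¹` by the lineage's decaying (2.44) on the central cube of its chart, the support
distance read from `d_{chart} ≥ d_T`, at most `3·2^{d+1}` terms per row. [cite: Balaban1984PropagatorsII, (2.64) p.234, (2.51)–(2.53) p.232, (2.44) p.230] -/
theorem rT_majorant (d ℓ : ℕ) (hℓ : 1 ≤ ℓ) (aminus aplus a2minus a2plus : ℝ) (ha : 0 < aminus) (ha2 : 0 < a2minus) :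
    ∃ δ₁ K : ℝ, 0 < δ₁ ∧ 0 < K ∧ ∀ (k Mh R : ℕ), 3 ≤ Mh → 2 * (ℓ + 1) ≤ R →
      ∀ (P : Fin (d + 1) → ℕ) (hP : ∀ μ, 1 ≤ P μ) (hP4 : ∀ μ, 4 ≤ P μ) (D : TDomains d ℓ Mh k P R) (a c : ℕ → ℝ),
        (∀ i, aminus ≤ a i ∧ a i ≤ aplus) → (∀ i, a2minus ≤ c i ∧ c i ≤ a2plus) →
        HasMajorant (g := geomT D) (blkOf D.toDomains) (Matrix.toLin' (rT D a c hP hP4))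
          (fun y y' => K / (((ℓ : ℝ) + 1) * Mh) * Real.exp (-(δ₁ / (d + 1) * (geomT D).dist y y'))) := by
  obtain ⟨δ', C, hδ', hC, hloc⟩ := local_comm_bound d ℓ hℓ aminus aplus a2minus a2plus ha ha2
  have hD1 := D1_nonneg contDiff_hprof hasCompactSupport_hprof
  have hD2 := D2_nonneg contDiff_hprof hasCompactSupport_hprof
  set Cb : ℝ := C * ((d + 1) * (D1 hprof + D2 hprof)) with hCb
  have hCb0 : 0 ≤ Cb := by positivity
  refine ⟨δ', (3 * 2 ^ (d + 1) * Cb + 1) * Real.exp δ', hδ', by positivity, ?_⟩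
  intro k Mh R hMh hR P hP hP4 D a c haw hcw y' μ B hμ x
  have hMh1 : 1 ≤ Mh := le_trans (by norm_num) hMh
  have hMh2 : 2 ≤ Mh := le_trans (by norm_num) hMh
  have hL1 : (1 : ℝ) ≤ (ℓ : ℝ) + 1 := by linarith [(Nat.cast_nonneg ℓ : (0 : ℝ) ≤ ℓ)]
  set M : ℝ := ((ℓ : ℝ) + 1) * Mh with hMdef
  have hM1 : (1 : ℝ) ≤ M := by
    have : (1 : ℝ) ≤ Mh := by exact_mod_cast hMh1
    rw [hMdef]; nlinarith
  have hMpos : 0 < M := by linarith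
  have hB0 : 0 ≤ B := hμ.nonneg
  rw [Matrix.toLin'_apply]
  -- the torus distance from the block of `x` to `y′`
  set dist0 : ℝ := (((bondT D).dist (blkOf D.toDomains x) y' : ℕ) : ℝ) with hdist0
  have hgeom : (geomT D).dist (blkOf D.toDomains x) y' = dist0 := rfl
  -- THE BOX LINEAGE'S BOUND OF ONE TERM, for ANY family on the fundamental box (file E's per-cube argument)
  have hbox : ∀ (D' : Domains d ℓ Mh k P R) (y'' : ↥(bset D')) (μ' : ↥(boxDom (N0 ℓ Mh k P)) → ℝ),
      BlockSupp (g := geom D') (blkOf D') μ' y'' B →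
      ∀ (x' : ↥(boxDom (N0 ℓ Mh k P))) (cq : ℕ × (Fin (d + 1) → ℤ)) (hc : CubeData D' cq),
        |(bX D' a c hP cq hc *ᵥ μ') x'|
          ≤ Cb / M * Real.exp δ' * Real.exp (-(δ' / (d + 1) * (((bond D').dist (blkOf D' x') y'' : ℕ) : ℝ))) * B := by
    intro D' y'' μ' hμ' x' cq hc
    have hμB : ∀ w, |μ' w| ≤ B := fun w => BlockSupp.abs_le hμ' w
    set dist1 : ℝ := (((bond D').dist (blkOf D' x') y'' : ℕ) : ℝ) with hdist1
    have hE1 : 0 ≤ Cb / M * Real.exp δ' * Real.exp (-(δ' / (d + 1) * dist1)) * B := by positivity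
    obtain ⟨-, hij, hji, -, -⟩ := fin_data hc
    have hjk := hc.hj.2
    by_cases himg : ∃ y, embC D' hP cq hc y = (castP (ℓ := ℓ) (Mh := Mh) (P := P) hij hjk).symm x'
    swap
    · push Not at himg
      rw [bX_row_off hP cq hc μ' himg, abs_zero]; exact hE1
    obtain ⟨y, hy⟩ := himg
    have hzval : ((castP (ℓ := ℓ) (Mh := Mh) (P := P) hij hjk).symm x').1 = x'.1 := by
      unfold castP; exact boxCast_symm_apply_val _ _
    have hyx : (embC D' hP cq hc y).1 = x'.1 := by rw [hy, hzval]
    -- `x′` lies in the cube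
    have hxin : InCube ℓ Mh k P cq.1 cq.2 x'.1 := by
      rw [← hzval]
      exact (inCube_iff_exists_emb (Mh := Mh) hP hij hc.hq _).2 ⟨y, hy⟩
    -- the cube data
    have hMh' : 2 ≤ MhP ℓ Mh cq.1 (fin D' cq.1 cq.2) := le_trans hMh2 (Nat.le_mul_of_pos_right _ (by positivity))
    have hMhle : (Mh : ℝ) ≤ MhP ℓ Mh cq.1 (fin D' cq.1 cq.2) := by
      unfold MhP; exact_mod_cast Nat.le_mul_of_pos_right _ (by positivity)
    have hMM' : M ≤ ((ℓ : ℝ) + 1) * (MhP ℓ Mh cq.1 (fin D' cq.1 cq.2) : ℝ) := by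
      rw [hMdef]; exact mul_le_mul_of_nonneg_left hMhle (by linarith)
    have hn : (0 : ℝ) < (((ℓ + 1) ^ fin D' cq.1 cq.2 : ℕ) : ℝ) := by positivity
    -- the support distance
    set Dd : ℝ := (((ℓ + 1) ^ fin D' cq.1 cq.2 : ℕ) : ℝ) * (dist1 / (d + 1) - 1) with hDd
    have hw : ∀ b, |((fun z => vFun D' cq.1 cq.2 z.1) ∘ embC D' hP cq hc) b| ≤ 1 := fun b => abs_vFun_le_one _ _ _
    have hu : ∀ b, |(res (embC D' hP cq hc) *ᵥ (μ' ∘ castP (fin_data hc).2.1 hc.hj.2)) b| ≤ B := fun b => by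
      rw [res_mulVec]; exact hμB _
    have hsupp : ∀ b, (res (embC D' hP cq hc) *ᵥ (μ' ∘ castP (fin_data hc).2.1 hc.hj.2)) b ≠ 0 →
        Dd ≤ supNorm (y.1 - b.1) := by
      intro b hb
      rw [res_mulVec, Function.comp_apply] at hb
      -- the site `x″ = cast(emb b)` lies in the cube and in the block `y″`
      set x'' : ↥(boxDom (N0 ℓ Mh k P)) := castP (fin_data hc).2.1 hc.hj.2 (embC D' hP cq hc b) with hx''
      have hx''val : x''.1 = (embC D' hP cq hc b).1 := by
        rw [hx'']; unfold castP; exact boxCast_apply_val _ _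
      have hx''in : InCube ℓ Mh k P cq.1 cq.2 x''.1 := by
        rw [hx''val]
        exact (inCube_iff_exists_emb (Mh := Mh) hP hij hc.hq _).2 ⟨b, rfl⟩
      have hblk : blkOf D' x'' = y'' := by
        by_contra hne
        exact hb (hμ'.off x'' hne)
      have h := Dd_le_supNorm hℓ hR hP hMh2 hc x' x'' hxin hx''in y'' hblk
      have hsub : x'.1 - x''.1 = y.1 - b.1 := by
        rw [hx''val, ← hyx]; unfold embC; exact emb_sub_emb _ hc.hq y b
      rw [hsub] at h
      exact h
    -- (2.44) on the cube, in stages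
    have h0 := hloc (fin D' cq.1 cq.2) (a (fin D' cq.1 cq.2)) (c (fin D' cq.1 cq.2)) (haw _).1 (haw _).2
      (hcw _).1 (hcw _).2 (MhP ℓ Mh cq.1 (fin D' cq.1 cq.2)) hMh' (Pj ℓ k P cq.1) (one_le_Pj hP cq.1) cq.2
      hc.hq (lamLoc ℓ (MhP ℓ Mh cq.1 (fin D' cq.1 cq.2)) (Pj ℓ k P cq.1) cq.2 (one_le_Pj hP cq.1) hc.hq
        (LamG D' cq.1 (fin D' cq.1 cq.2)))
      (isBlockUnion_lamLoc _ hc.hq (isBlockUnion_LamG (D := D') hij hjk))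
    have h1 := h0 ((fun z => vFun D' cq.1 cq.2 z.1) ∘ embC D' hP cq hc)
      (res (embC D' hP cq hc) *ᵥ (μ' ∘ castP (fin_data hc).2.1 hc.hj.2))
    have h2 := h1 B Dd
    have h3 := h2 hw
    have h4 := h3 hu
    have h5 := h4 y
    have h := h5 hsupp
    rw [bX_row_img hP cq hc μ' hy]
    unfold embC at h
    unfold cOp cG embC
    refine h.trans ?_
    -- the constants: `C(d+1)(…)/M_□ ≤ Cb/M`, the exponent `e^{−δ′D/L^i} = e^{δ′}e^{−δ′dist/(d+1)}`
    have hκ : C * ((d + 1) * (D1 hprof + D2 hprof) / (((ℓ : ℝ) + 1) * (MhP ℓ Mh cq.1 (fin D' cq.1 cq.2) : ℝ)))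
        ≤ Cb / M := by
      have hM'pos : (0 : ℝ) < ((ℓ : ℝ) + 1) * (MhP ℓ Mh cq.1 (fin D' cq.1 cq.2) : ℝ) := lt_of_lt_of_le hMpos hMM'
      rw [hCb]
      calc C * ((d + 1) * (D1 hprof + D2 hprof) / (((ℓ : ℝ) + 1) * (MhP ℓ Mh cq.1 (fin D' cq.1 cq.2) : ℝ)))
          = C * ((d + 1) * (D1 hprof + D2 hprof)) * (1 / (((ℓ : ℝ) + 1) * (MhP ℓ Mh cq.1 (fin D' cq.1 cq.2) : ℝ))) := by
            ring
        _ ≤ C * ((d + 1) * (D1 hprof + D2 hprof)) * (1 / M) :=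
            mul_le_mul_of_nonneg_left (one_div_le_one_div_of_le hMpos hMM') (by positivity)
        _ = C * ((d + 1) * (D1 hprof + D2 hprof)) / M := by ring
    have hexp : Real.exp (-(δ' * Dd / (((ℓ + 1) ^ fin D' cq.1 cq.2 : ℕ) : ℝ)))
        = Real.exp δ' * Real.exp (-(δ' / (d + 1) * dist1)) := by
      rw [hDd]; exact exp_Dd_eq hn d
    rw [hexp]
    have : 0 ≤ Real.exp δ' * Real.exp (-(δ' / (d + 1) * dist1)) * B := by positivity
    calc C * ((d + 1) * (D1 hprof + D2 hprof) / (((ℓ : ℝ) + 1) * (MhP ℓ Mh cq.1 (fin D' cq.1 cq.2) : ℝ)))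
          * (Real.exp δ' * Real.exp (-(δ' / (d + 1) * dist1))) * B
        = C * ((d + 1) * (D1 hprof + D2 hprof) / (((ℓ : ℝ) + 1) * (MhP ℓ Mh cq.1 (fin D' cq.1 cq.2) : ℝ)))
          * (Real.exp δ' * Real.exp (-(δ' / (d + 1) * dist1)) * B) := by ring
      _ ≤ Cb / M * (Real.exp δ' * Real.exp (-(δ' / (d + 1) * dist1)) * B) := mul_le_mul_of_nonneg_right hκ this
      _ = Cb / M * Real.exp δ' * Real.exp (-(δ' / (d + 1) * dist1)) * B := by ring
  -- the bound of one TORUS term: the box bound in its chart, the chart distance dominating the torus distance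
  set E : ℝ := Cb / M * Real.exp δ' * Real.exp (-(δ' / (d + 1) * dist0)) * B with hE
  have hE0 : 0 ≤ E := by positivity
  have hterm : ∀ (cq : ℕ × (Fin (d + 1) → ℤ)) (hc : CubeDataT D cq), |(bT D a c hP hP4 cq hc *ᵥ μ) x| ≤ E := by
    intro cq hc
    unfold bT
    rw [reindex_mulVec_apply]
    obtain ⟨b, hb⟩ := blkMap_surjective (D := D) hMh1 hP (svec ℓ k cq.1 cq.2) y'
    have hμ' : BlockSupp (g := geom (Dc D cq.1 cq.2)) (blkOf (Dc D cq.1 cq.2)) (μ ∘ σc ℓ Mh k P cq.1 cq.2) b B :=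
      blockSupp_chart hMh1 hP (svec ℓ k cq.1 cq.2) hμ hb
    have h := hbox (Dc D cq.1 cq.2) b (μ ∘ σc ℓ Mh k P cq.1 cq.2) hμ' ((σc ℓ Mh k P cq.1 cq.2).symm x)
      (cq.1, qc ℓ k cq.1 cq.2) (cubeData_chart hP4 hc)
    refine h.trans ?_
    have hd : dist0 ≤ (((bond (Dc D cq.1 cq.2)).dist (blkOf (Dc D cq.1 cq.2) ((σc ℓ Mh k P cq.1 cq.2).symm x)) b
        : ℕ) : ℝ) := by
      rw [hdist0, ← hb]
      exact_mod_cast distT_blkOf_le_chart hMh1 hP (svec ℓ k cq.1 cq.2) x b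
    rw [hE]
    have hexp : Real.exp (-(δ' / (d + 1) * (((bond (Dc D cq.1 cq.2)).dist
          (blkOf (Dc D cq.1 cq.2) ((σc ℓ Mh k P cq.1 cq.2).symm x)) b : ℕ) : ℝ)))
        ≤ Real.exp (-(δ' / (d + 1) * dist0)) := by
      rw [Real.exp_le_exp, neg_le_neg_iff]
      exact mul_le_mul_of_nonneg_left hd (by positivity)
    have h0 : 0 ≤ Cb / M * Real.exp δ' := by positivity
    exact mul_le_mul_of_nonneg_right (mul_le_mul_of_nonneg_left hexp h0) hB0
  -- summing over the cover: at most `3·2^{d+1}` terms meet the row of `x`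
  unfold rT
  rw [Matrix.sum_mulVec, Finset.sum_apply, Finset.attach_eq_univ]
  refine (Finset.abs_sum_le_sum_abs _ _).trans ?_
  have key := sum_le_card_mul
    (fun cq : {cq // cq ∈ cubeSetT D} => |(bT D a c hP hP4 cq.1 (cubeDataT_of_mem cq.2) *ᵥ μ) x|)
    (fun cq => (cq.1.1, Qmap ℓ Mh k P cq.1.1 x.1 cq.1.2)) (keyT_injective D x.1) (keySet ℓ Mh (D.lev x.1) x.1)
    (fun cq hq0 => mem_keySet_of_bT_ne_zero hℓ hR hP hP4 hMh cq.1 (cubeDataT_of_mem cq.2) μ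
      (fun h0 => hq0 (by rw [h0, abs_zero])))
    hE0 (fun cq => hterm cq.1 (cubeDataT_of_mem cq.2))
  refine key.trans ?_
  have hcard : ((keySet ℓ Mh (D.lev x.1) x.1).card : ℝ) ≤ 3 * 2 ^ (d + 1) := by
    exact_mod_cast card_keySet_le _ _ _ _
  dsimp only
  rw [hgeom]
  have hE' : 3 * 2 ^ (d + 1) * E
      ≤ (3 * 2 ^ (d + 1) * Cb + 1) * Real.exp δ' / M * Real.exp (-(δ' / (d + 1) * dist0)) * B := by
    rw [hE]
    have : 0 ≤ Real.exp δ' / M * Real.exp (-(δ' / (d + 1) * dist0)) * B := by positivity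
    calc 3 * 2 ^ (d + 1) * (Cb / M * Real.exp δ' * Real.exp (-(δ' / (d + 1) * dist0)) * B)
        = (3 * 2 ^ (d + 1) * Cb) * (Real.exp δ' / M * Real.exp (-(δ' / (d + 1) * dist0)) * B) := by ring
      _ ≤ (3 * 2 ^ (d + 1) * Cb + 1) * (Real.exp δ' / M * Real.exp (-(δ' / (d + 1) * dist0)) * B) :=
          mul_le_mul_of_nonneg_right (by linarith) this
      _ = _ := by ring
  calc ((keySet ℓ Mh (D.lev x.1) x.1).card : ℝ) * E ≤ 3 * 2 ^ (d + 1) * E :=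
        mul_le_mul_of_nonneg_right hcard hE0
    _ ≤ (3 * 2 ^ (d + 1) * Cb + 1) * Real.exp δ' / M * Real.exp (-(δ' / (d + 1) * dist0)) * B := hE'
    _ = (3 * 2 ^ (d + 1) * Cb + 1) * Real.exp δ' / (((ℓ : ℝ) + 1) * Mh) * Real.exp (-(δ' / (d + 1) * dist0)) * B := by
        rw [hMdef]

end RMajorant

/-! ## §3 The majorant of `G′₀` on the torus blocks `𝔅` -/

section GMajorant

/-- **THE MAJORANT OF `G′₀` ON `𝔅` FOR THE GENUINE `k`-LEVEL OPERATOR ON THE TORUS**: there are `δ₂, A > 0` (functions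
of `d`, `ℓ`, windows — the box lineage's) such that for every `k`, `M_h ≥ 3`, `R ≥ 2L`, torus size (`P_μ ≥ 4`), family `D`
and weights in the windows, `|(G′₀λ)(x)| ≤ A·L^{2j}·e^{−(δ₂/(d+1))·d_T(y,y′)}|λ|` for `x ∈ B^j(y)`, `supp λ ⊂ B^{j′}(y′)`
— each transported term `σ(h_□G′(□)v_□)σ⁻¹` by (2.43) on the central cube of its chart in the decaying form, the
lattice-unit factor `L^{2i_□} ≤ L^{2j}`, the support distance read from `d_{chart} ≥ d_T`, and at most `3·2^{d+1}` terms
per row. [cite: Balaban1984PropagatorsII, (2.66) p.234 (the G′₀ factor «O(1)(L^jη)²»), (2.43) p.230, (2.53) p.232] -/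
theorem gZeroT_majorant (d ℓ : ℕ) (hℓ : 1 ≤ ℓ) (aminus aplus a2minus a2plus : ℝ) (ha : 0 < aminus)
    (ha2 : 0 < a2minus) :
    ∃ δ₂ A : ℝ, 0 < δ₂ ∧ 0 < A ∧ ∀ (k Mh R : ℕ), 3 ≤ Mh → 2 * (ℓ + 1) ≤ R →
      ∀ (P : Fin (d + 1) → ℕ) (hP : ∀ μ, 1 ≤ P μ) (hP4 : ∀ μ, 4 ≤ P μ) (D : TDomains d ℓ Mh k P R) (a c : ℕ → ℝ),
        (∀ i, aminus ≤ a i ∧ a i ≤ aplus) → (∀ i, a2minus ≤ c i ∧ c i ≤ a2plus) →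
        HasMajorant (g := geomT D) (blkOf D.toDomains) (Matrix.toLin' (gZeroT D a c hP hP4))
          (fun y y' => A * ((ℓ : ℝ) + 1) ^ (2 * y.1.1) * Real.exp (-(δ₂ / (d + 1) * (geomT D).dist y y'))) := by
  obtain ⟨δ'', c', hδ'', hc', h243⟩ := ineq243_twoLevel_roww d ℓ hℓ aminus aplus 0 a2minus a2plus ha ha2
  refine ⟨δ'', 3 * 2 ^ (d + 1) * c' * Real.exp δ'', hδ'', by positivity, ?_⟩
  intro k Mh R hMh hR P hP hP4 D a c haw hcw y' μ B hμ x
  have hMh1 : 1 ≤ Mh := le_trans (by norm_num) hMh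
  have hMh2 : 2 ≤ Mh := le_trans (by norm_num) hMh
  have hL1 : (1 : ℝ) ≤ (ℓ : ℝ) + 1 := by linarith [(Nat.cast_nonneg ℓ : (0 : ℝ) ≤ ℓ)]
  have hB0 : 0 ≤ B := hμ.nonneg
  rw [Matrix.toLin'_apply]
  set dist0 : ℝ := (((bondT D).dist (blkOf D.toDomains x) y' : ℕ) : ℝ) with hdist0
  have hgeom : (geomT D).dist (blkOf D.toDomains x) y' = dist0 := rfl
  have hlevx : (blkOf D.toDomains x).1.1 = D.lev x.1 := rfl
  -- THE BOX LINEAGE'S BOUND OF ONE TERM, for ANY family on the fundamental box (file E's per-cube argument)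
  have hbox : ∀ (D' : Domains d ℓ Mh k P R) (y'' : ↥(bset D')) (μ' : ↥(boxDom (N0 ℓ Mh k P)) → ℝ),
      BlockSupp (g := geom D') (blkOf D') μ' y'' B →
      ∀ (x' : ↥(boxDom (N0 ℓ Mh k P))) (cq : ℕ × (Fin (d + 1) → ℤ)) (hc : CubeData D' cq),
        |(aX D' a c hP cq hc *ᵥ μ') x'|
          ≤ ((ℓ : ℝ) + 1) ^ (2 * D'.lev x'.1)
            * (c' * Real.exp δ'' * Real.exp (-(δ'' / (d + 1) * (((bond D').dist (blkOf D' x') y'' : ℕ) : ℝ))) * B) := by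
    intro D' y'' μ' hμ' x' cq hc
    have hμB : ∀ w, |μ' w| ≤ B := fun w => BlockSupp.abs_le hμ' w
    set dist1 : ℝ := (((bond D').dist (blkOf D' x') y'' : ℕ) : ℝ) with hdist1
    have hE1 : 0 ≤ ((ℓ : ℝ) + 1) ^ (2 * D'.lev x'.1)
        * (c' * Real.exp δ'' * Real.exp (-(δ'' / (d + 1) * dist1)) * B) := by positivity
    obtain ⟨-, hij, hji, -, -⟩ := fin_data hc
    have hjk := hc.hj.2
    rw [aX_mulVec_apply]
    by_cases himg : ∃ y, embC D' hP cq hc y = (castP (ℓ := ℓ) (Mh := Mh) (P := P) hij hjk).symm x'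
    swap
    · push Not at himg
      rw [gX_row_off hP cq hc _ himg, mul_zero, abs_zero]; exact hE1
    obtain ⟨y, hy⟩ := himg
    have hzval : ((castP (ℓ := ℓ) (Mh := Mh) (P := P) hij hjk).symm x').1 = x'.1 := by
      unfold castP; exact boxCast_symm_apply_val _ _
    have hyx : (embC D' hP cq hc y).1 = x'.1 := by rw [hy, hzval]
    have hxin : InCube ℓ Mh k P cq.1 cq.2 x'.1 := by
      rw [← hzval]
      exact (inCube_iff_exists_emb (Mh := Mh) hP hij hc.hq _).2 ⟨y, hy⟩
    have hlevwin := lev_window_of_inCube hℓ hR hP hMh2 hc x'.2 hxin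
    have hMh' : 1 ≤ MhP ℓ Mh cq.1 (fin D' cq.1 cq.2) := one_le_MhP hMh1 _ _
    have hcM' : ∀ μ, 1 ≤ cubeM' (MhP ℓ Mh cq.1 (fin D' cq.1 cq.2)) (Pj ℓ k P cq.1) cq.2 μ := fun μ =>
      Nat.one_le_iff_ne_zero.2 (Nat.mul_ne_zero_iff.2
        ⟨by omega, by have := (one_le_cubeW (one_le_Pj hP cq.1) hc.hq μ).1; omega⟩)
    have hn : (0 : ℝ) < (((ℓ + 1) ^ fin D' cq.1 cq.2 : ℕ) : ℝ) := by positivity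
    set Dd : ℝ := (((ℓ + 1) ^ fin D' cq.1 cq.2 : ℕ) : ℝ) * (dist1 / (d + 1) - 1) with hDd
    -- the vector `u = res(v_□μ′ ∘ cast)` on the cube
    have hF : ∀ b, |(res (embC D' hP cq hc) *ᵥ ((Matrix.diagonal (vX D' cq) *ᵥ μ') ∘ castP (fin_data hc).2.1 hc.hj.2)) b|
        ≤ B := by
      intro b
      rw [res_mulVec, Function.comp_apply, Matrix.mulVec_diagonal, abs_mul]
      calc |vX D' cq _| * |μ' _| ≤ 1 * B := mul_le_mul (abs_vFun_le_one _ _ _) (hμB _) (abs_nonneg _) zero_le_one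
        _ = B := one_mul _
    have hD : ∀ b, (res (embC D' hP cq hc) *ᵥ ((Matrix.diagonal (vX D' cq) *ᵥ μ') ∘ castP (fin_data hc).2.1 hc.hj.2)) b
        ≠ 0 → Dd ≤ supNorm (y.1 - b.1) := by
      intro b hb
      rw [res_mulVec, Function.comp_apply, Matrix.mulVec_diagonal] at hb
      set x'' : ↥(boxDom (N0 ℓ Mh k P)) := castP (fin_data hc).2.1 hc.hj.2 (embC D' hP cq hc b) with hx''
      have hμx : μ' x'' ≠ 0 := fun h0 => hb (by rw [h0, mul_zero])
      have hx''val : x''.1 = (embC D' hP cq hc b).1 := by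
        rw [hx'']; unfold castP; exact boxCast_apply_val _ _
      have hx''in : InCube ℓ Mh k P cq.1 cq.2 x''.1 := by
        rw [hx''val]
        exact (inCube_iff_exists_emb (Mh := Mh) hP hij hc.hq _).2 ⟨b, rfl⟩
      have hblk : blkOf D' x'' = y'' := by
        by_contra hne
        exact hμx (hμ'.off x'' hne)
      have h := Dd_le_supNorm hℓ hR hP hMh2 hc x' x'' hxin hx''in y'' hblk
      have hsub : x'.1 - x''.1 = y.1 - b.1 := by
        rw [hx''val, ← hyx]; unfold embC; exact emb_sub_emb _ hc.hq y b
      rw [hsub] at h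
      exact h
    -- (2.43) on the cube, in the decaying form
    have hrow : roww δ'' ((ℓ + 1) ^ fin D' cq.1 cq.2) (cG D' a c cq.1 (fin D' cq.1 cq.2) cq.2 hP hc.hq) y ≤ c' :=
      h243 (fin D' cq.1 cq.2) (a (fin D' cq.1 cq.2)) 0 (c (fin D' cq.1 cq.2)) (haw _).1 (haw _).2 le_rfl
        le_rfl (hcw _).1 (hcw _).2 _ hcM' _ y
    have hdec := mulVec_le_of_roww hδ''.le ((ℓ + 1) ^ fin D' cq.1 cq.2)
      (cG D' a c cq.1 (fin D' cq.1 cq.2) cq.2 hP hc.hq) y hrow _ hF hD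
    rw [gX_row_img hP cq hc _ hy, abs_mul, abs_mul]
    -- `|h_□| ≤ 1`, `(L^i)² ≤ L^{2·lev x′}`, the exponent bookkeeping
    have huX : |uX (ℓ := ℓ) (Mh := Mh) (k := k) (P := P) cq x'| ≤ 1 := abs_hq_le_one _ _ _ _
    have hsq : |((((ℓ : ℝ) + 1)) ^ fin D' cq.1 cq.2) ^ 2| ≤ ((ℓ : ℝ) + 1) ^ (2 * D'.lev x'.1) := by
      rw [abs_of_nonneg (by positivity), ← pow_mul]
      exact pow_le_pow_right₀ hL1 (by omega)
    have hexp : Real.exp (-(δ'' * Dd / (((ℓ + 1) ^ fin D' cq.1 cq.2 : ℕ) : ℝ)))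
        = Real.exp δ'' * Real.exp (-(δ'' / (d + 1) * dist1)) := by
      rw [hDd]; exact exp_Dd_eq hn d
    rw [hexp] at hdec
    have h3 : 0 ≤ c' * (Real.exp δ'' * Real.exp (-(δ'' / (d + 1) * dist1))) * B := by positivity
    calc |uX cq x'| * (|((((ℓ : ℝ) + 1)) ^ fin D' cq.1 cq.2) ^ 2| * |(cG D' a c cq.1 (fin D' cq.1 cq.2) cq.2 hP hc.hq
            *ᵥ (res (embC D' hP cq hc) *ᵥ ((Matrix.diagonal (vX D' cq) *ᵥ μ') ∘ castP (fin_data hc).2.1 hc.hj.2))) y|)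
        ≤ 1 * (((ℓ : ℝ) + 1) ^ (2 * D'.lev x'.1) * (c' * (Real.exp δ'' * Real.exp (-(δ'' / (d + 1) * dist1))) * B)) :=
          mul_le_mul huX (mul_le_mul hsq hdec (abs_nonneg _) (by positivity)) (by positivity) zero_le_one
      _ = ((ℓ : ℝ) + 1) ^ (2 * D'.lev x'.1) * (c' * Real.exp δ'' * Real.exp (-(δ'' / (d + 1) * dist1)) * B) := by
          ring
  -- the bound of one TORUS term
  set E : ℝ := ((ℓ : ℝ) + 1) ^ (2 * D.lev x.1) * (c' * Real.exp δ'' * Real.exp (-(δ'' / (d + 1) * dist0)) * B)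
    with hE
  have hE0 : 0 ≤ E := by positivity
  have hterm : ∀ (cq : ℕ × (Fin (d + 1) → ℤ)) (hc : CubeDataT D cq), |(aT D a c hP hP4 cq hc *ᵥ μ) x| ≤ E := by
    intro cq hc
    unfold aT
    rw [reindex_mulVec_apply]
    obtain ⟨b, hb⟩ := blkMap_surjective (D := D) hMh1 hP (svec ℓ k cq.1 cq.2) y'
    have hμ' : BlockSupp (g := geom (Dc D cq.1 cq.2)) (blkOf (Dc D cq.1 cq.2)) (μ ∘ σc ℓ Mh k P cq.1 cq.2) b B :=
      blockSupp_chart hMh1 hP (svec ℓ k cq.1 cq.2) hμ hb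
    have h := hbox (Dc D cq.1 cq.2) b (μ ∘ σc ℓ Mh k P cq.1 cq.2) hμ' ((σc ℓ Mh k P cq.1 cq.2).symm x)
      (cq.1, qc ℓ k cq.1 cq.2) (cubeData_chart hP4 hc)
    rw [Dc_lev_symm] at h
    refine h.trans ?_
    have hd : dist0 ≤ (((bond (Dc D cq.1 cq.2)).dist (blkOf (Dc D cq.1 cq.2) ((σc ℓ Mh k P cq.1 cq.2).symm x)) b
        : ℕ) : ℝ) := by
      rw [hdist0, ← hb]
      exact_mod_cast distT_blkOf_le_chart hMh1 hP (svec ℓ k cq.1 cq.2) x b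
    rw [hE]
    have hexp : Real.exp (-(δ'' / (d + 1) * (((bond (Dc D cq.1 cq.2)).dist
          (blkOf (Dc D cq.1 cq.2) ((σc ℓ Mh k P cq.1 cq.2).symm x)) b : ℕ) : ℝ)))
        ≤ Real.exp (-(δ'' / (d + 1) * dist0)) := by
      rw [Real.exp_le_exp, neg_le_neg_iff]
      exact mul_le_mul_of_nonneg_left hd (by positivity)
    have h0 : 0 ≤ c' * Real.exp δ'' := by positivity
    exact mul_le_mul_of_nonneg_left (mul_le_mul_of_nonneg_right (mul_le_mul_of_nonneg_left hexp h0) hB0)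
      (by positivity)
  -- summing over the cover
  unfold gZeroT
  rw [Matrix.sum_mulVec, Finset.sum_apply, Finset.attach_eq_univ]
  refine (Finset.abs_sum_le_sum_abs _ _).trans ?_
  have key := sum_le_card_mul
    (fun cq : {cq // cq ∈ cubeSetT D} => |(aT D a c hP hP4 cq.1 (cubeDataT_of_mem cq.2) *ᵥ μ) x|)
    (fun cq => (cq.1.1, Qmap ℓ Mh k P cq.1.1 x.1 cq.1.2)) (keyT_injective D x.1) (keySet ℓ Mh (D.lev x.1) x.1)
    (fun cq hq0 => mem_keySet_of_aT_ne_zero hℓ hR hP hP4 hMh2 cq.1 (cubeDataT_of_mem cq.2) μ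
      (fun h0 => hq0 (by rw [h0, abs_zero])))
    hE0 (fun cq => hterm cq.1 (cubeDataT_of_mem cq.2))
  refine key.trans ?_
  have hcard : ((keySet ℓ Mh (D.lev x.1) x.1).card : ℝ) ≤ 3 * 2 ^ (d + 1) := by
    exact_mod_cast card_keySet_le _ _ _ _
  dsimp only
  rw [hgeom, hlevx]
  calc ((keySet ℓ Mh (D.lev x.1) x.1).card : ℝ) * E ≤ 3 * 2 ^ (d + 1) * E :=
        mul_le_mul_of_nonneg_right hcard hE0
    _ = 3 * 2 ^ (d + 1) * c' * Real.exp δ'' * ((ℓ : ℝ) + 1) ^ (2 * D.lev x.1)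
          * Real.exp (-(δ'' / (d + 1) * dist0)) * B := by rw [hE]; ring

end GMajorant

/-! ## §4 Proposition 2.2, first entry, for the genuine `k`-level operator on the torus -/

section Prop22

variable {ℓ Mh k R : ℕ} {P : Fin (d + 1) → ℕ}

/-- **THE FIXED POINT `G′ = G′₀ + G′R`** of (2.38)/(2.50) for the genuine operator on the torus, as linear maps: from
`Δ′_aG′₀ = 1 − R` (file T2) and `G′Δ′_a = 1` (file T1). [cite: Balaban1984PropagatorsII, (2.38) p.229, (2.50) p.232] -/
theorem fixedPoint_gmlT (D : TDomains d ℓ Mh k P R) {a c : ℕ → ℝ} (hℓ : 1 ≤ ℓ) (hR : 2 * (ℓ + 1) ≤ R)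
    (hP : ∀ μ, 1 ≤ P μ) (hP4 : ∀ μ, 4 ≤ P μ) (hMh : 2 ≤ Mh) (ha : ∀ i, 0 < a i)
    (hcpos : ∀ i, 0 < c i) (hac : ∀ i, a (i + 1) = aNext ℓ (a i) (c i)) :
    Matrix.toLin' (gmlT (N0 ℓ Mh k P) ℓ k D.lev a)
      = Matrix.toLin' (gZeroT D a c hP hP4)
        + Matrix.toLin' (gmlT (N0 ℓ Mh k P) ℓ k D.lev a) * Matrix.toLin' (rT D a c hP hP4) := by
  have h238 := eq238_multiLevelTorus (D := D) (a := a) (c := c) hℓ hR hP hP4 hMh ha hcpos hac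
  have hGE : gmlT (N0 ℓ Mh k P) ℓ k D.lev a * mlOpT (N0 ℓ Mh k P) ℓ k D.lev a = 1 :=
    gmlT_mul_mlOpT (one_le_N0 (le_trans (by norm_num) hMh) hP) D.lev_le ha
  have hmat : gmlT (N0 ℓ Mh k P) ℓ k D.lev a
      = gZeroT D a c hP hP4 + gmlT (N0 ℓ Mh k P) ℓ k D.lev a * rT D a c hP hP4 := by
    have h := congrArg (fun T => gmlT (N0 ℓ Mh k P) ℓ k D.lev a * T) h238
    rw [← Matrix.mul_assoc, hGE, Matrix.one_mul, Matrix.mul_sub, Matrix.mul_one] at h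
    rw [h]; abel
  conv_lhs => rw [hmat]
  rw [map_add, Module.End.mul_eq_comp, ← Matrix.toLin'_mul]

/-- **[B6] PROPOSITION 2.2, FIRST ENTRY OF (2.67), FOR THE GENUINE `k`-LEVEL OPERATOR `G′ = Δ′_a^{−1}` ON THE TORUS
`T_η`** (print's carrier, `Ω₁ = T_η`): there are `δ₀, C, M₀ > 0` and `N₀ ≥ 1` (functions of `d`, `ℓ` and the windows —
NOT of the torus) such that for EVERY number of levels `k`, `M_h ≥ 3` with `L·M_h ≥ M₀` («M is sufficiently large»),
`R ≥ 2L` with `RM ≥ N₀ + 1` ((2.59)), torus size `P` (`P_μ ≥ 4`), nested family `D` of domains of the torus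
(2.1)–(2.2), and weights `a_i ∈ [a₋, a₊]`, `c_i ∈ [c₋, c₊]` with `a_{i+1} = aNext ℓ a_i c_i`:
`|(G′λ)(x)| ≤ C·L^{2j}·e^{−½δ₀d_T(y,y′)}·|λ|` for `x ∈ B^j(y)`, `y ∈ Λ_j`, `supp λ ⊂ B^{j′}(y′)`, `y′ ∈ Λ_{j′}`
(`HasMajorant` on `geomT D`, lattice units) — by the printed route: the majorants of `R` ((2.64), §2) and of `G′₀` (§3),
Lemma 2.1 on the torus (file T3) and the chain (2.64)–(2.66) (`B6Prop23Chain.majorant_of_fixedPoint_266W`) applied to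
the fixed point `G′ = G′₀ + G′R`. [cite: Balaban1984PropagatorsII, Proposition 2.2 (2.67) p.234, (2.64)–(2.66) p.234, p.224 (Ω₁ = T_η admitted)] -/
theorem prop22_first_multiLevelTorus (d ℓ : ℕ) (hℓ : 1 ≤ ℓ) (aminus aplus a2minus a2plus : ℝ) (ha : 0 < aminus)
    (ha2 : 0 < a2minus) :
    ∃ δ₀ C M₀ : ℝ, ∃ N₀ : ℕ, 0 < δ₀ ∧ 0 < C ∧ 0 < M₀ ∧ 0 < N₀ ∧
      ∀ (k Mh R : ℕ), 3 ≤ Mh → M₀ ≤ ((ℓ : ℝ) + 1) * Mh → 2 * (ℓ + 1) ≤ R → N₀ + 1 ≤ R * ((ℓ + 1) * Mh) →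
      ∀ (P : Fin (d + 1) → ℕ) (hP : ∀ μ, 1 ≤ P μ) (hP4 : ∀ μ, 4 ≤ P μ) (D : TDomains d ℓ Mh k P R) (a c : ℕ → ℝ),
        (∀ i, aminus ≤ a i ∧ a i ≤ aplus) → (∀ i, a2minus ≤ c i ∧ c i ≤ a2plus) →
        (∀ i, a (i + 1) = aNext ℓ (a i) (c i)) →
        HasMajorant (g := geomT D) (blkOf D.toDomains) (Matrix.toLin' (gmlT (N0 ℓ Mh k P) ℓ k D.lev a))
          (fun y y' => C * ((ℓ : ℝ) + 1) ^ (2 * y.1.1) * Real.exp (-(δ₀ / 2 * (geomT D).dist y y'))) := by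
  obtain ⟨δ₁, K, hδ₁, hK, hRmaj⟩ := rT_majorant d ℓ hℓ aminus aplus a2minus a2plus ha ha2
  obtain ⟨δ₂, A, hδ₂, hA, hGmaj⟩ := gZeroT_majorant d ℓ hℓ aminus aplus a2minus a2plus ha ha2
  have hL0 : (0 : ℝ) < (ℓ : ℝ) + 1 := by positivity
  have hL1 : (1 : ℝ) ≤ (ℓ : ℝ) + 1 := by linarith [(Nat.cast_nonneg ℓ : (0 : ℝ) ≤ ℓ)]
  -- the rate `δ₀ = min(δ₁, δ₂)/(d+1)` and the (2.59)-threshold `N₀`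
  set δ₀ : ℝ := min δ₁ δ₂ / (d + 1) with hδ₀
  have hδ₀pos : 0 < δ₀ := by rw [hδ₀]; exact div_pos (lt_min hδ₁ hδ₂) (by positivity)
  set N₀ : ℕ := ⌈4 * ((d : ℝ) + 1) * ((ℓ : ℝ) + 1) / (1 / 2 * δ₀)⌉₊ + 1 with hN₀
  have hN₀pos : 0 < N₀ := by rw [hN₀]; omega
  have hθlt : Real.exp (-(1 / 2 * δ₀)) * ((ℓ : ℝ) + 1) ^ ((2 * (d + 1 : ℕ) : ℝ) / N₀) < 1 := by
    refine theta_lt_one_of_log hL0 hN₀pos ?_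
    have hlog : Real.log ((ℓ : ℝ) + 1) ≤ (ℓ : ℝ) + 1 := (Real.log_le_sub_one_of_pos hL0).trans (by linarith)
    have hN₀ge : 4 * ((d : ℝ) + 1) * ((ℓ : ℝ) + 1) / (1 / 2 * δ₀) < (N₀ : ℝ) := by
      rw [hN₀]; push_cast
      exact lt_of_le_of_lt (Nat.le_ceil _) (by linarith)
    have hσ : (0 : ℝ) < 1 / 2 * δ₀ := by positivity
    rw [div_lt_iff₀ hσ] at hN₀ge
    push_cast
    nlinarith [mul_nonneg (by positivity : (0 : ℝ) ≤ 2 * ((d : ℝ) + 1)) (Real.log_nonneg hL1)]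
  -- the (2.61)-constant and «M sufficiently large»
  set cK : ℝ := K261 N₀ (d + 1) ((ℓ : ℝ) + 1) 1 (1 / 2 * δ₀) with hcK
  have hcK0 : 0 ≤ cK := K261_nonneg (by positivity) zero_le_one
  set M₀ : ℝ := 2 * K * cK + 1 with hM₀
  refine ⟨δ₀, 2 * A * cK + 1, M₀, N₀, hδ₀pos, by positivity, by positivity, hN₀pos, ?_⟩
  intro k Mh R hMh hM hR hRM P hP hP4 D a c haw hcw hac
  have hMh1 : 1 ≤ Mh := le_trans (by norm_num) hMh
  have hMh2 : 2 ≤ Mh := le_trans (by norm_num) hMh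
  have hMpos : (0 : ℝ) < ((ℓ : ℝ) + 1) * Mh := by
    have : (1 : ℝ) ≤ Mh := by exact_mod_cast hMh1
    positivity
  -- the majorants of `R` and `G′₀`, at the common rate `δ₀`
  set θ : ℝ := K / (((ℓ : ℝ) + 1) * Mh) with hθ
  have hθ0 : 0 ≤ θ := by positivity
  have hdnn : ∀ y y' : (geomT D).Site, 0 ≤ (geomT D).dist y y' := (triangle_refl_nonneg_T D hMh1 hP).2.2
  have hrate : ∀ (δ : ℝ), min δ₁ δ₂ ≤ δ → ∀ y y' : (geomT D).Site,
      Real.exp (-(δ / (d + 1) * (geomT D).dist y y')) ≤ Real.exp (-(δ₀ * (geomT D).dist y y')) := by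
    intro δ hδ y y'
    rw [Real.exp_le_exp, hδ₀, neg_le_neg_iff]
    exact mul_le_mul_of_nonneg_right (div_le_div_of_nonneg_right hδ (by positivity)) (hdnn y y')
  have hRm : HasMajorant (g := geomT D) (blkOf D.toDomains) (Matrix.toLin' (rT D a c hP hP4))
      (fun y y' => θ * Real.exp (-(δ₀ * (geomT D).dist y y'))) :=
    hasMajorant_mono (blkOf D.toDomains) (hRmaj k Mh R hMh hR P hP hP4 D a c haw hcw) fun y y' =>
      mul_le_mul_of_nonneg_left (hrate δ₁ (min_le_left _ _) y y') hθ0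
  have hGm : HasMajorant (g := geomT D) (blkOf D.toDomains) (Matrix.toLin' (gZeroT D a c hP hP4))
      (fun y y' => A * ((ℓ : ℝ) + 1) ^ (2 * y.1.1) * Real.exp (-(δ₀ * (geomT D).dist y y'))) :=
    hasMajorant_mono (blkOf D.toDomains) (hGmaj k Mh R hMh hR P hP hP4 D a c haw hcw) fun y y' =>
      mul_le_mul_of_nonneg_left (hrate δ₂ (min_le_right _ _) y y') (by positivity)
  -- Lemma 2.1 on the torus with `α = ½`
  obtain ⟨-, h261, -, h263⟩ := lemma21_torus D hMh1 hP hN₀pos hRM hδ₀pos.le (α := 1 / 2) (by norm_num)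
    (by norm_num) hθlt
  obtain ⟨htri, hrefl, -⟩ := triangle_refl_nonneg_T D hMh1 hP
  -- the smallness `θ·c < 1` from `M ≥ M₀`
  have hsmall : θ * cK ≤ 1 / 2 := by
    rw [hθ, div_mul_eq_mul_div, div_le_iff₀ hMpos]
    have : 2 * K * cK + 1 ≤ ((ℓ : ℝ) + 1) * Mh := hM
    nlinarith
  have hsmall' : θ * cK < 1 := by linarith
  -- the fixed point and the chain
  have hfix := fixedPoint_gmlT D (c := c) hℓ hR hP hP4 hMh2 (fun i => lt_of_lt_of_le ha (haw i).1)
    (fun i => lt_of_lt_of_le ha2 (hcw i).1) hac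
  have hchain := majorant_of_fixedPoint_266W (g := geomT D) (blkOf D.toDomains) cK δ₀ (1 / 2) θ A
    (fun y => ((ℓ : ℝ) + 1) ^ (2 * y.1.1)) hA.le (fun y => by positivity) hθ0 hcK0
    (by nlinarith [hδ₀pos.le] : (0 : ℝ) ≤ (1 - 1 / 2) * δ₀) htri hrefl hdnn h261 h263 hsmall' hGm hRm hfix
  refine hasMajorant_mono (g := geomT D) (blkOf D.toDomains) hchain fun y y' => ?_
  have hinv : (1 - θ * cK)⁻¹ ≤ 2 := by
    rw [inv_le_comm₀ (by linarith) (by norm_num)]; linarith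
  have hexp0 : 0 ≤ Real.exp (-((1 - 1 / 2) * δ₀ * (geomT D).dist y y')) := (Real.exp_pos _).le
  have hP0 : 0 ≤ ((ℓ : ℝ) + 1) ^ (2 * y.1.1) := by positivity
  have hrate2 : Real.exp (-((1 - 1 / 2) * δ₀ * (geomT D).dist y y'))
      = Real.exp (-(δ₀ / 2 * (geomT D).dist y y')) := by
    congr 1; ring
  rw [← hrate2]
  have h1 : A * cK * (1 - θ * cK)⁻¹ ≤ 2 * A * cK + 1 := by
    have : A * cK * (1 - θ * cK)⁻¹ ≤ A * cK * 2 := mul_le_mul_of_nonneg_left hinv (by positivity)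
    linarith
  calc A * cK * (1 - θ * cK)⁻¹ * ((ℓ : ℝ) + 1) ^ (2 * y.1.1) * Real.exp (-((1 - 1 / 2) * δ₀ * (geomT D).dist y y'))
      = A * cK * (1 - θ * cK)⁻¹
          * (((ℓ : ℝ) + 1) ^ (2 * y.1.1) * Real.exp (-((1 - 1 / 2) * δ₀ * (geomT D).dist y y'))) := by ring
    _ ≤ (2 * A * cK + 1) * (((ℓ : ℝ) + 1) ^ (2 * y.1.1) * Real.exp (-((1 - 1 / 2) * δ₀ * (geomT D).dist y y'))) :=
        mul_le_mul_of_nonneg_right h1 (mul_nonneg hP0 hexp0)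
    _ = (2 * A * cK + 1) * ((ℓ : ℝ) + 1) ^ (2 * y.1.1) * Real.exp (-((1 - 1 / 2) * δ₀ * (geomT D).dist y y')) := by
        ring

end Prop22

end

end Literature.MathematicalPhysics.QuantumFieldTheory.Balaban1983to89.B6Prop22MultiLevelTorusL0
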